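import Summits.CriticalPhenomena.PercolationContinuityZ3.Theorems.TransplantHeisenbergZ
import HarnessLib

/-!
# `Cay(H₃(ℤ) × ℤ, {A^±, B^±, T^±})` is connected — the commutator walk

Builds on p205010 (kernel theorem, internal audit signed; external expert review pending).  Lane
`prim-bschramm`, rung R3a (memo `run/shared/lean/prim/bschramm/P3-NILPOTENT.md` §6.2(c)).  Proof-only sequel
of `TransplantHeisenbergZ.lean`: every vertex `(a,b,c,t)` is reached from `0` by `Aᵃ`, then `Bᵇ` (which
lands at `(a,b,ab,0)`), then `|c − ab|` commutator loops `A B A⁻¹ B⁻¹` (each raising `c` by one) or their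
reverses, then `Tᵗ`.  Connectivity is a hypothesis of Burton–Keane uniqueness and of Martineau–Severo's
Cor. 2.2, both consumed by the (D5) instance of this rung. [folklore]
-/

noncomputable section

namespace Summit.CriticalPhenomena.PercolationContinuityZ3.Theorems.HeisenbergZ

open Literature.Probability.Percolation Literature.Probability.LatticeModels

/-! ## Connectivity (the commutator walk) -/

/-- Reachability from `0` is stable under right multiplication by a generator. [folklore] -/
theorem reachable_mul_gen {x : HZ} (hx : heisenbergZGraph.Reachable 0 x) {s : HZ}
    (hs : s = gA ∨ s = gB ∨ s = gT ∨ s = gAinv ∨ s = gBinv ∨ s = gTinv) :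
    heisenbergZGraph.Reachable 0 (hzMul x s) :=
  hx.trans (adj_mul_gen x hs).reachable

/-- `0 ↝ (a,0,0,0)`. [folklore] -/
theorem reachable_axisA (a : ℤ) : heisenbergZGraph.Reachable 0 ![a, 0, 0, 0] := by
  induction a using Int.induction_on with
  | zero =>
    have : (![0, 0, 0, 0] : HZ) = 0 := by ext i; fin_cases i <;> rfl
    rw [this]
  | succ n ih =>
    have h := reachable_mul_gen ih (s := gA) (Or.inl rfl)
    have he : hzMul ![(n : ℤ), 0, 0, 0] gA = ![(n : ℤ) + 1, 0, 0, 0] := by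
      ext i; fin_cases i <;> simp [hzMul, gA]
    rwa [he] at h
  | pred n ih =>
    have h := reachable_mul_gen ih (s := gAinv) (Or.inr (Or.inr (Or.inr (Or.inl rfl))))
    have he : hzMul ![-(n : ℤ), 0, 0, 0] gAinv = ![-(n : ℤ) - 1, 0, 0, 0] := by
      ext i; fin_cases i <;> simp [hzMul, gAinv, sub_eq_add_neg]
    rwa [he] at h

/-- `0 ↝ (a,b,ab,0)`. [folklore] -/
theorem reachable_AB (a b : ℤ) : heisenbergZGraph.Reachable 0 ![a, b, a * b, 0] := by
  induction b using Int.induction_on with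
  | zero => simpa using reachable_axisA a
  | succ n ih =>
    have h := reachable_mul_gen ih (s := gB) (Or.inr (Or.inl rfl))
    have he : hzMul ![a, (n : ℤ), a * n, 0] gB = ![a, (n : ℤ) + 1, a * (n + 1), 0] := by
      ext i; fin_cases i <;> simp [hzMul, gB]
      ring
    rwa [he] at h
  | pred n ih =>
    have h := reachable_mul_gen ih (s := gBinv) (Or.inr (Or.inr (Or.inr (Or.inr (Or.inl rfl)))))
    have he : hzMul ![a, -(n : ℤ), a * -n, 0] gBinv = ![a, -(n : ℤ) - 1, a * (-n - 1), 0] := by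
      ext i; fin_cases i <;> simp [hzMul, gBinv] <;> ring
    rwa [he] at h

/-- The commutator walk `x, xA, xAB, xABA⁻¹, xABA⁻¹B⁻¹ = x·C` raises `c` by one. [folklore] -/
theorem commutator_up (x : HZ) :
    hzMul (hzMul (hzMul (hzMul x gA) gB) gAinv) gBinv = ![x 0, x 1, x 2 + 1, x 3] := by
  ext i; fin_cases i <;> simp [hzMul, gA, gB, gAinv, gBinv]
  ring

/-- The reverse commutator walk lowers `c` by one. [folklore] -/
theorem commutator_down (x : HZ) :
    hzMul (hzMul (hzMul (hzMul x gB) gA) gBinv) gAinv = ![x 0, x 1, x 2 - 1, x 3] := by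
  ext i; fin_cases i <;> simp [hzMul, gA, gB, gAinv, gBinv]
  ring

/-- `0 ↝ (a,b,ab+m,0)` for every `m`. [folklore] -/
theorem reachable_ABC (a b m : ℤ) : heisenbergZGraph.Reachable 0 ![a, b, a * b + m, 0] := by
  induction m using Int.induction_on with
  | zero => simpa using reachable_AB a b
  | succ n ih =>
    have h1 := reachable_mul_gen ih (s := gA) (Or.inl rfl)
    have h2 := reachable_mul_gen h1 (s := gB) (Or.inr (Or.inl rfl))
    have h3 := reachable_mul_gen h2 (s := gAinv) (Or.inr (Or.inr (Or.inr (Or.inl rfl))))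
    have h4 := reachable_mul_gen h3 (s := gBinv) (Or.inr (Or.inr (Or.inr (Or.inr (Or.inl rfl)))))
    rw [commutator_up] at h4
    have he : (![(![a, b, a * b + n, 0] : HZ) 0, (![a, b, a * b + n, 0] : HZ) 1,
        (![a, b, a * b + n, 0] : HZ) 2 + 1, (![a, b, a * b + n, 0] : HZ) 3] : HZ) =
        ![a, b, a * b + (n + 1), 0] := by
      ext i; fin_cases i <;> simp
      ring
    rwa [he] at h4
  | pred n ih =>
    have h1 := reachable_mul_gen ih (s := gB) (Or.inr (Or.inl rfl))
    have h2 := reachable_mul_gen h1 (s := gA) (Or.inl rfl)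
    have h3 := reachable_mul_gen h2 (s := gBinv) (Or.inr (Or.inr (Or.inr (Or.inr (Or.inl rfl)))))
    have h4 := reachable_mul_gen h3 (s := gAinv) (Or.inr (Or.inr (Or.inr (Or.inl rfl))))
    rw [commutator_down] at h4
    have he : (![(![a, b, a * b + -n, 0] : HZ) 0, (![a, b, a * b + -n, 0] : HZ) 1,
        (![a, b, a * b + -n, 0] : HZ) 2 - 1, (![a, b, a * b + -n, 0] : HZ) 3] : HZ) =
        ![a, b, a * b + (-n - 1), 0] := by
      ext i; fin_cases i <;> simp
      ring
    rwa [he] at h4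

/-- `0 ↝ (a,b,c,t)` for every vertex. [folklore] -/
theorem reachable_all (a b c t : ℤ) : heisenbergZGraph.Reachable 0 ![a, b, c, t] := by
  have h0 : heisenbergZGraph.Reachable 0 ![a, b, c, 0] := by
    have := reachable_ABC a b (c - a * b)
    rwa [add_sub_cancel] at this
  induction t using Int.induction_on with
  | zero => exact h0
  | succ n ih =>
    have h := reachable_mul_gen ih (s := gT) (Or.inr (Or.inr (Or.inl rfl)))
    have he : hzMul ![a, b, c, (n : ℤ)] gT = ![a, b, c, (n : ℤ) + 1] := by
      ext i; fin_cases i <;> simp [hzMul, gT]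
    rwa [he] at h
  | pred n ih =>
    have h := reachable_mul_gen ih (s := gTinv) (Or.inr (Or.inr (Or.inr (Or.inr (Or.inr rfl)))))
    have he : hzMul ![a, b, c, -(n : ℤ)] gTinv = ![a, b, c, -(n : ℤ) - 1] := by
      ext i; fin_cases i <;> simp [hzMul, gTinv, sub_eq_add_neg]
    rwa [he] at h

/-- **`Cay(H₃(ℤ) × ℤ)` is connected.** [folklore] -/
theorem heisenbergZGraph_connected : heisenbergZGraph.Connected := by
  haveI : Nonempty HZ := ⟨0⟩
  refine SimpleGraph.Connected.mk fun x y => ?_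
  have hx : heisenbergZGraph.Reachable 0 x := by
    have := reachable_all (x 0) (x 1) (x 2) (x 3)
    have he : (![x 0, x 1, x 2, x 3] : HZ) = x := by ext i; fin_cases i <;> rfl
    rwa [he] at this
  have hy : heisenbergZGraph.Reachable 0 y := by
    have := reachable_all (y 0) (y 1) (y 2) (y 3)
    have he : (![y 0, y 1, y 2, y 3] : HZ) = y := by ext i; fin_cases i <;> rfl
    rwa [he] at this
  exact hx.symm.trans hy


end Summit.CriticalPhenomena.PercolationContinuityZ3.Theorems.HeisenbergZ
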